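import Mathlib
import HarnessLib
import Summits.ValiantsHypothesis.ValiantsHypothesis.Theorems.LacunarySymmetroidMatrixDescartesOsculationLawCuspNonMonicCount
import Summits.ValiantsHypothesis.ValiantsHypothesis.Theorems.LacunarySymmetroidMatrixDescartesOsculationLawRankTwoColumnDet
import Summits.ValiantsHypothesis.ValiantsHypothesis.Theorems.LacunarySymmetroidMatrixDescartesOsculationLawRankTwoColumnSupport

/-!
# ValiantsHypothesis / LacunarySymmetroid — crux `MatrixDescartes` (stmt-ValiantsHypothesis-18050, V1),
# line `Cruxes/MatrixDescartes/Lines/osculation_law.lean` («osculation-law»): the RANK-TWO COLUMN of the osculation law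

For the splitting `(r, s) = (2, s)` of `OsculationLawAt (s+2) K ·` — a RANK-TWO semidefinite letter `b·(I₂ ⊕ 0)` inserted
into a symmetric pencil of ANY size `m = s + 2` — the insertion polynomial is the non-monic quadratic
`a·b² + m·b + δ` of `OsculationRankTwo.insertionPoly_two` (`a = det G₂₂`, `m` = the two diagonal cofactors, `δ = det G`;
exponents in `s•E`, `(s+1)•E`, `(s+2)•E`), real-rooted by `OsculationRankTwo.hdisc_two` (Schur complement).  The abstract
count `OsculationCuspGen.nonmonic_cusp_ncard_le` (p609205) with the pseudo-remainder pair of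
`OsculationCuspGen.hess_reduce_poly` (p605555) and the symbolic monomial counts of `…RankTwoColumnSupport` give, for
`a ≢ 0`, `#osc ≤ K^(15s+12) + 2K^(7s+5) + 2K^(7s+6)`; for `a ≡ 0` the letter is rank-one-shaped and
`OsculationRankOne.osc_ncard_le` gives `≤ K^(4s+6)`.  Hence the explicit column

  `osc_two_s (s K d S) : … (osculation set finite) → #osc ≤ 5 · K ^ (15 s + 12)`

for every `s`, `K` (the line's vocabulary UNFOLDED verbatim; at `s = 1` this re-derives `OsculationThreeK.osc_two_one`).
Together with the rank-zero and rank-one columns (`OsculationTwoK.osculationLawAt_rankZero/rankOne`), every splitting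
with `r ≤ 2` of every format is now bounded polynomially in `K` for fixed `m`.  Honest framing: a located COLUMN of an
UNREGISTERED V1 law line with a Descartes ceiling polynomial in `K` for each size but NOT inside the law's envelope
`2^(C (K + log₂² m))` uniformly in `m`; the splittings `r ≥ 3`, `OsculationLaw`, `PeelInequality`, `stub_recursion`,
`MatrixDescartes`, Conjecture B and `VP ≠ VNP` stay OPEN / NOT proved.  No definitions, no named facts; Mathlib + tree
osculation files only.
-/

-- `Summit.ValiantsHypothesis.ValiantsHypothesis.…` is the tree's mandated single-conjunct layout (Sub = Summit).
set_option linter.dupNamespace false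

noncomputable section

namespace Summit.ValiantsHypothesis.ValiantsHypothesis.Theorems.LacunarySymmetroidMatrixDescartes

open Polynomial Set
open scoped BigOperators Pointwise

namespace OsculationRankTwo

open OsculationCusp OsculationTwoK

-- the proof instantiates `hess_reduce_poly` / `nonmonic_cusp_ncard_le` with the explicit `U`, `V`: slow elaboration.
set_option maxHeartbeats 1600000 in
/-- **The rank-two column of the osculation law.**  For every `s`, `K`, every exponent vector `d` and every symmetric
block pencil `S : Fin K → Matrix (Fin 2 ⊕ Fin s) (Fin 2 ⊕ Fin s) ℝ`: if the osculation set of the spectral curve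
`det(Σ_l t^(d l) S_l + b·(I₂ ⊕ 0)) = 0` (the line's `osculationSet d S`, UNFOLDED verbatim) is finite, it has at most
`5 · K^(15 s + 12)` points — the `(2, s)` splitting of `OsculationLawAt (s + 2) K (5 K^(15s+12))`. -/
theorem osc_two_s (s K : ℕ) (d : Fin K → ℕ) (S : Fin K → Matrix (Fin 2 ⊕ Fin s) (Fin 2 ⊕ Fin s) ℝ)
    (hS : ∀ l, (S l).IsSymm) (hfin : {p : Fin 2 → ℝ | 0 < p 0 ∧ 0 < p 1 ∧ MvPolynomial.eval p (∑ l, (MvPolynomial.X (0 : Fin 2) : MvPolynomial (Fin 2) ℝ) ^ d l •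
              (S l).map (MvPolynomial.C : ℝ →+* MvPolynomial (Fin 2) ℝ)
            + (MvPolynomial.X (1 : Fin 2) : MvPolynomial (Fin 2) ℝ) •
              (Matrix.fromBlocks 1 0 0 0 : Matrix (Fin 2 ⊕ Fin s) (Fin 2 ⊕ Fin s) ℝ).map
                (MvPolynomial.C : ℝ →+* MvPolynomial (Fin 2) ℝ)).det = 0 ∧
      MvPolynomial.eval p
        (MvPolynomial.X 0 * MvPolynomial.pderiv 0 (MvPolynomial.X 0 * MvPolynomial.pderiv 0 (∑ l, (MvPolynomial.X (0 : Fin 2) : MvPolynomial (Fin 2) ℝ) ^ d l •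
              (S l).map (MvPolynomial.C : ℝ →+* MvPolynomial (Fin 2) ℝ)
            + (MvPolynomial.X (1 : Fin 2) : MvPolynomial (Fin 2) ℝ) •
              (Matrix.fromBlocks 1 0 0 0 : Matrix (Fin 2 ⊕ Fin s) (Fin 2 ⊕ Fin s) ℝ).map
                (MvPolynomial.C : ℝ →+* MvPolynomial (Fin 2) ℝ)).det)
            * (MvPolynomial.X 1 * MvPolynomial.pderiv 1 (∑ l, (MvPolynomial.X (0 : Fin 2) : MvPolynomial (Fin 2) ℝ) ^ d l •
              (S l).map (MvPolynomial.C : ℝ →+* MvPolynomial (Fin 2) ℝ)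
            + (MvPolynomial.X (1 : Fin 2) : MvPolynomial (Fin 2) ℝ) •
              (Matrix.fromBlocks 1 0 0 0 : Matrix (Fin 2 ⊕ Fin s) (Fin 2 ⊕ Fin s) ℝ).map
                (MvPolynomial.C : ℝ →+* MvPolynomial (Fin 2) ℝ)).det) ^ 2
          - 2 * (MvPolynomial.X 0 * MvPolynomial.pderiv 0 (MvPolynomial.X 1 * MvPolynomial.pderiv 1 (∑ l, (MvPolynomial.X (0 : Fin 2) : MvPolynomial (Fin 2) ℝ) ^ d l •
              (S l).map (MvPolynomial.C : ℝ →+* MvPolynomial (Fin 2) ℝ)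
            + (MvPolynomial.X (1 : Fin 2) : MvPolynomial (Fin 2) ℝ) •
              (Matrix.fromBlocks 1 0 0 0 : Matrix (Fin 2 ⊕ Fin s) (Fin 2 ⊕ Fin s) ℝ).map
                (MvPolynomial.C : ℝ →+* MvPolynomial (Fin 2) ℝ)).det))
            * (MvPolynomial.X 0 * MvPolynomial.pderiv 0 (∑ l, (MvPolynomial.X (0 : Fin 2) : MvPolynomial (Fin 2) ℝ) ^ d l •
              (S l).map (MvPolynomial.C : ℝ →+* MvPolynomial (Fin 2) ℝ)
            + (MvPolynomial.X (1 : Fin 2) : MvPolynomial (Fin 2) ℝ) •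
              (Matrix.fromBlocks 1 0 0 0 : Matrix (Fin 2 ⊕ Fin s) (Fin 2 ⊕ Fin s) ℝ).map
                (MvPolynomial.C : ℝ →+* MvPolynomial (Fin 2) ℝ)).det) * (MvPolynomial.X 1 * MvPolynomial.pderiv 1 (∑ l, (MvPolynomial.X (0 : Fin 2) : MvPolynomial (Fin 2) ℝ) ^ d l •
              (S l).map (MvPolynomial.C : ℝ →+* MvPolynomial (Fin 2) ℝ)
            + (MvPolynomial.X (1 : Fin 2) : MvPolynomial (Fin 2) ℝ) •
              (Matrix.fromBlocks 1 0 0 0 : Matrix (Fin 2 ⊕ Fin s) (Fin 2 ⊕ Fin s) ℝ).map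
                (MvPolynomial.C : ℝ →+* MvPolynomial (Fin 2) ℝ)).det)
          + MvPolynomial.X 1 * MvPolynomial.pderiv 1 (MvPolynomial.X 1 * MvPolynomial.pderiv 1 (∑ l, (MvPolynomial.X (0 : Fin 2) : MvPolynomial (Fin 2) ℝ) ^ d l •
              (S l).map (MvPolynomial.C : ℝ →+* MvPolynomial (Fin 2) ℝ)
            + (MvPolynomial.X (1 : Fin 2) : MvPolynomial (Fin 2) ℝ) •
              (Matrix.fromBlocks 1 0 0 0 : Matrix (Fin 2 ⊕ Fin s) (Fin 2 ⊕ Fin s) ℝ).map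
                (MvPolynomial.C : ℝ →+* MvPolynomial (Fin 2) ℝ)).det)
            * (MvPolynomial.X 0 * MvPolynomial.pderiv 0 (∑ l, (MvPolynomial.X (0 : Fin 2) : MvPolynomial (Fin 2) ℝ) ^ d l •
              (S l).map (MvPolynomial.C : ℝ →+* MvPolynomial (Fin 2) ℝ)
            + (MvPolynomial.X (1 : Fin 2) : MvPolynomial (Fin 2) ℝ) •
              (Matrix.fromBlocks 1 0 0 0 : Matrix (Fin 2 ⊕ Fin s) (Fin 2 ⊕ Fin s) ℝ).map
                (MvPolynomial.C : ℝ →+* MvPolynomial (Fin 2) ℝ)).det) ^ 2) = 0}.Finite) :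
    {p : Fin 2 → ℝ | 0 < p 0 ∧ 0 < p 1 ∧ MvPolynomial.eval p (∑ l, (MvPolynomial.X (0 : Fin 2) : MvPolynomial (Fin 2) ℝ) ^ d l •
              (S l).map (MvPolynomial.C : ℝ →+* MvPolynomial (Fin 2) ℝ)
            + (MvPolynomial.X (1 : Fin 2) : MvPolynomial (Fin 2) ℝ) •
              (Matrix.fromBlocks 1 0 0 0 : Matrix (Fin 2 ⊕ Fin s) (Fin 2 ⊕ Fin s) ℝ).map
                (MvPolynomial.C : ℝ →+* MvPolynomial (Fin 2) ℝ)).det = 0 ∧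
      MvPolynomial.eval p
        (MvPolynomial.X 0 * MvPolynomial.pderiv 0 (MvPolynomial.X 0 * MvPolynomial.pderiv 0 (∑ l, (MvPolynomial.X (0 : Fin 2) : MvPolynomial (Fin 2) ℝ) ^ d l •
              (S l).map (MvPolynomial.C : ℝ →+* MvPolynomial (Fin 2) ℝ)
            + (MvPolynomial.X (1 : Fin 2) : MvPolynomial (Fin 2) ℝ) •
              (Matrix.fromBlocks 1 0 0 0 : Matrix (Fin 2 ⊕ Fin s) (Fin 2 ⊕ Fin s) ℝ).map
                (MvPolynomial.C : ℝ →+* MvPolynomial (Fin 2) ℝ)).det)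
            * (MvPolynomial.X 1 * MvPolynomial.pderiv 1 (∑ l, (MvPolynomial.X (0 : Fin 2) : MvPolynomial (Fin 2) ℝ) ^ d l •
              (S l).map (MvPolynomial.C : ℝ →+* MvPolynomial (Fin 2) ℝ)
            + (MvPolynomial.X (1 : Fin 2) : MvPolynomial (Fin 2) ℝ) •
              (Matrix.fromBlocks 1 0 0 0 : Matrix (Fin 2 ⊕ Fin s) (Fin 2 ⊕ Fin s) ℝ).map
                (MvPolynomial.C : ℝ →+* MvPolynomial (Fin 2) ℝ)).det) ^ 2
          - 2 * (MvPolynomial.X 0 * MvPolynomial.pderiv 0 (MvPolynomial.X 1 * MvPolynomial.pderiv 1 (∑ l, (MvPolynomial.X (0 : Fin 2) : MvPolynomial (Fin 2) ℝ) ^ d l •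
              (S l).map (MvPolynomial.C : ℝ →+* MvPolynomial (Fin 2) ℝ)
            + (MvPolynomial.X (1 : Fin 2) : MvPolynomial (Fin 2) ℝ) •
              (Matrix.fromBlocks 1 0 0 0 : Matrix (Fin 2 ⊕ Fin s) (Fin 2 ⊕ Fin s) ℝ).map
                (MvPolynomial.C : ℝ →+* MvPolynomial (Fin 2) ℝ)).det))
            * (MvPolynomial.X 0 * MvPolynomial.pderiv 0 (∑ l, (MvPolynomial.X (0 : Fin 2) : MvPolynomial (Fin 2) ℝ) ^ d l •
              (S l).map (MvPolynomial.C : ℝ →+* MvPolynomial (Fin 2) ℝ)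
            + (MvPolynomial.X (1 : Fin 2) : MvPolynomial (Fin 2) ℝ) •
              (Matrix.fromBlocks 1 0 0 0 : Matrix (Fin 2 ⊕ Fin s) (Fin 2 ⊕ Fin s) ℝ).map
                (MvPolynomial.C : ℝ →+* MvPolynomial (Fin 2) ℝ)).det) * (MvPolynomial.X 1 * MvPolynomial.pderiv 1 (∑ l, (MvPolynomial.X (0 : Fin 2) : MvPolynomial (Fin 2) ℝ) ^ d l •
              (S l).map (MvPolynomial.C : ℝ →+* MvPolynomial (Fin 2) ℝ)
            + (MvPolynomial.X (1 : Fin 2) : MvPolynomial (Fin 2) ℝ) •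
              (Matrix.fromBlocks 1 0 0 0 : Matrix (Fin 2 ⊕ Fin s) (Fin 2 ⊕ Fin s) ℝ).map
                (MvPolynomial.C : ℝ →+* MvPolynomial (Fin 2) ℝ)).det)
          + MvPolynomial.X 1 * MvPolynomial.pderiv 1 (MvPolynomial.X 1 * MvPolynomial.pderiv 1 (∑ l, (MvPolynomial.X (0 : Fin 2) : MvPolynomial (Fin 2) ℝ) ^ d l •
              (S l).map (MvPolynomial.C : ℝ →+* MvPolynomial (Fin 2) ℝ)
            + (MvPolynomial.X (1 : Fin 2) : MvPolynomial (Fin 2) ℝ) •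
              (Matrix.fromBlocks 1 0 0 0 : Matrix (Fin 2 ⊕ Fin s) (Fin 2 ⊕ Fin s) ℝ).map
                (MvPolynomial.C : ℝ →+* MvPolynomial (Fin 2) ℝ)).det)
            * (MvPolynomial.X 0 * MvPolynomial.pderiv 0 (∑ l, (MvPolynomial.X (0 : Fin 2) : MvPolynomial (Fin 2) ℝ) ^ d l •
              (S l).map (MvPolynomial.C : ℝ →+* MvPolynomial (Fin 2) ℝ)
            + (MvPolynomial.X (1 : Fin 2) : MvPolynomial (Fin 2) ℝ) •
              (Matrix.fromBlocks 1 0 0 0 : Matrix (Fin 2 ⊕ Fin s) (Fin 2 ⊕ Fin s) ℝ).map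
                (MvPolynomial.C : ℝ →+* MvPolynomial (Fin 2) ℝ)).det) ^ 2) = 0}.ncard ≤ 5 * K ^ (15 * s + 12) := by

  classical
  have hEK : (Finset.univ.image d).card ≤ K := (Finset.card_image_le).trans (by simp)
  obtain ⟨h27, h10⟩ := column_arith K s
  have hΦ := insertionPoly_two d S
  have ha : ((∑ l, (X : ℝ[X]) ^ d l • ((S l).toBlocks₂₂).map Polynomial.C).det).support ⊆ s • Finset.univ.image d :=
    supp_cast (supp_det_pencil d fun l => (S l).toBlocks₂₂) (by simp)
  have hm : (((∑ l, (X : ℝ[X]) ^ d l • (S l).map Polynomial.C).updateRow (Sum.inl 0) (Pi.single (Sum.inl 0) 1 : Fin 2 ⊕ Fin s → ℝ[X])).det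
              + ((∑ l, (X : ℝ[X]) ^ d l • (S l).map Polynomial.C).updateRow (Sum.inl 1) (Pi.single (Sum.inl 1) 1 : Fin 2 ⊕ Fin s → ℝ[X])).det).support ⊆
      (s + 1) • Finset.univ.image d :=
    supp_add (supp_cast (supp_det_updateRow_single d S (Sum.inl 0)) (by simp [Fintype.card_sum]; omega))
      (supp_cast (supp_det_updateRow_single d S (Sum.inl 1)) (by simp [Fintype.card_sum]; omega))
  have hδ : ((∑ l, (X : ℝ[X]) ^ d l • (S l).map Polynomial.C).det).support ⊆ (s + 2) • Finset.univ.image d :=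
    supp_cast (supp_det_pencil d S) (by simp [Fintype.card_sum, Fintype.card_fin]; ring)
  by_cases ha0 : (∑ l, (X : ℝ[X]) ^ d l • ((S l).toBlocks₂₂).map Polynomial.C).det = 0
  · -- rank-one shape `Φ = ι δ + X₁·ι m`
    have hΦ' : (∑ l, (MvPolynomial.X (0 : Fin 2) : MvPolynomial (Fin 2) ℝ) ^ d l •
              (S l).map (MvPolynomial.C : ℝ →+* MvPolynomial (Fin 2) ℝ)
            + (MvPolynomial.X (1 : Fin 2) : MvPolynomial (Fin 2) ℝ) •
              (Matrix.fromBlocks 1 0 0 0 : Matrix (Fin 2 ⊕ Fin s) (Fin 2 ⊕ Fin s) ℝ).map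
                (MvPolynomial.C : ℝ →+* MvPolynomial (Fin 2) ℝ)).det =
        Polynomial.aeval (MvPolynomial.X 0 : MvPolynomial (Fin 2) ℝ) (∑ l, (X : ℝ[X]) ^ d l • (S l).map Polynomial.C).det
          + MvPolynomial.X 1 * Polynomial.aeval (MvPolynomial.X 0 : MvPolynomial (Fin 2) ℝ)
            (((∑ l, (X : ℝ[X]) ^ d l • (S l).map Polynomial.C).updateRow (Sum.inl 0) (Pi.single (Sum.inl 0) 1 : Fin 2 ⊕ Fin s → ℝ[X])).det
              + ((∑ l, (X : ℝ[X]) ^ d l • (S l).map Polynomial.C).updateRow (Sum.inl 1) (Pi.single (Sum.inl 1) 1 : Fin 2 ⊕ Fin s → ℝ[X])).det) := by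
      rw [hΦ, ha0, map_zero, mul_zero, zero_add, add_comm]
    refine (OsculationRankOne.osc_ncard_le _ _ _ hΦ' hfin).trans ?_
    refine (OsculationRankOne.card_roots_filter_pos_le_card_support _).trans ?_
    exact ((card_support_le_of_subset_nsmul (supp_R_gen _ _ _ s hδ hm)).trans (Nat.pow_le_pow_left hEK _)).trans h10
  · have hcount := OsculationCuspGen.nonmonic_cusp_ncard_le _ _ _ _ _ _ hΦ ha0 (hdisc_two d S hS)
      (fun t b hΨ => OsculationCuspGen.hess_reduce_poly _ _ _ _ _ t b _ _ _ _ _ _ _ _ _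
        rfl rfl rfl rfl rfl rfl rfl rfl rfl rfl rfl hΨ) hfin
    have hN := (card_support_le_of_subset_nsmul (supp_N_gen _ _ _ _ s ha hm hδ)).trans (Nat.pow_le_pow_left hEK _)
    have hU := (card_support_le_of_subset_nsmul (supp_U_gen _ _ _ _ s ha hm hδ)).trans (Nat.pow_le_pow_left hEK _)
    have hV := (card_support_le_of_subset_nsmul (supp_V_gen _ _ _ _ s ha hm hδ)).trans (Nat.pow_le_pow_left hEK _)
    exact hcount.trans ((Nat.add_le_add (Nat.add_le_add hN (Nat.mul_le_mul_left 2 hU))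
      (Nat.mul_le_mul_left 2 hV)).trans h27)

end OsculationRankTwo

end Summit.ValiantsHypothesis.ValiantsHypothesis.Theorems.LacunarySymmetroidMatrixDescartes
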